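import Summits.QuantumAdvantage.AdviceFreeQNC0.GaugeDefs
import Summits.QuantumAdvantage.AdviceFreeQNC0.StructuredWord
import Summits.QuantumAdvantage.AdviceFreeQNC0.BlockParityChar
import HarnessLib

/-!
# Cell qa-qnc0 (rung F-Q2-odd, `p = 3`): vocabulary for the gauge-transport count (ROUND-15 §3.4–3.6)

Planner qa-qnc0-p1 g16, `ROUND-15.md` §3 (formalisation map L3–L6), for THEOREM A′ `PredHardDWB3`.  Definitions only
(the proofs are the files `GaugeAverage`, `GaugeCount`, `StructuredBound`, `PredHard`):

* `Fib P` (tuples of block words with product `P`), `BlkSet G` (block contents with words `G`), the fibre average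
  `avgB` and `Vsum F x P = Σ_{G ∈ Fib P} avgB F x G`, the resampling tables `Tbl`, `piProdSplit`, Kilian's inverse `kil`;
* the outside representatives `Yset`, `zerosOut`, the admissibility predicate `AdmS` / sign bit `εb`, the sign `sgnP` and
  the affine permutations `affP b t : z ↦ ỹ(b) z + t`;
* the structured pattern `Sx y c` (blocks `cbOf c` of `c ∈ {0,1}^{Kℓ}` driving the gadgets of `StructuredWord.lean`,
  window content `swin`), its stake data `t0Of`, `etaOf`, and a chosen filler `fbOf ∈ fib(affP b τ)`.

WHAT THIS IS NOT: no theorem of substance here; separation NOT moved.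
-/

noncomputable section

namespace Summit.QuantumAdvantage.AdviceFreeQNC0

namespace DWalk

open Finset Equiv
open Literature.Computability.MetaComplexity Literature.Computability.MetaComplexity.Smolensky

section Vocab

variable {n : ℕ} (a L m : ℕ) (κ₀ : ZMod 3) (K ℓ : ℕ) {Lf : ℕ}

/-- Tuples of block words with product `P`. -/
def Fib (P : Perm (ZMod 3)) : Finset (Fin (m + 1) → Perm (ZMod 3)) :=
  univ.filter fun G => Fin.partialProd G (Fin.last (m + 1)) = P

/-- Block contents whose block words are `G`. -/
def BlkSet (G : Fin (m + 1) → Perm (ZMod 3)) : Finset (Fin (m + 1) → Fin L → Bool) :=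
  univ.filter fun B => ∀ j, blockPerm κ₀ (B j) = G j

/-- The average of `F(glue x B)` over the block contents compatible with `G`. -/
def avgB (F : (Fin (n + 1) → Bool) → ℝ) (x : Fin (n + 1) → Bool) (G : Fin (m + 1) → Perm (ZMod 3)) : ℝ :=
  (∑ B ∈ BlkSet L m κ₀ G, F (glue a L m x (unblk L m B))) / ∏ j, ((fib κ₀ L (G j)).card : ℝ)

/-- `V F x P = Σ_{G ∈ Fib P} avgB F x G`. -/
def Vsum (F : (Fin (n + 1) → Bool) → ℝ) (x : Fin (n + 1) → Bool) (P : Perm (ZMod 3)) : ℝ :=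
  ∑ G ∈ Fib m P, avgB a L m κ₀ F x G

/-- The type of resampling tables. -/
abbrev Tbl (L m : ℕ) (κ₀ : ZMod 3) : Type := (j : Fin (m + 1)) → (g : Perm (ZMod 3)) → ↥(fib κ₀ L g)

variable {a L m κ₀}

/-- Membership in `Fib`. -/
theorem mem_Fib {P : Perm (ZMod 3)} {G : Fin (m + 1) → Perm (ZMod 3)} :
    G ∈ Fib m P ↔ Fin.partialProd G (Fin.last (m + 1)) = P := by simp [Fib]

/-- Membership in `BlkSet`. -/
theorem mem_BlkSet {G : Fin (m + 1) → Perm (ZMod 3)} {B : Fin (m + 1) → Fin L → Bool} :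
    B ∈ BlkSet L m κ₀ G ↔ ∀ j, blockPerm κ₀ (B j) = G j := by simp [BlkSet]

/-- `V` sees only the outside bits. -/
theorem Vsum_glue (F : (Fin (n + 1) → Bool) → ℝ) (x : Fin (n + 1) → Bool) (w : Fin ((m + 1) * L) → Bool)
    (P : Perm (ZMod 3)) : Vsum a L m κ₀ F (glue a L m x w) P = Vsum a L m κ₀ F x P := by
  unfold Vsum avgB; simp only [glue_glue]

/-- `avgB ≥ 0` for `F ≥ 0`. -/
theorem avgB_nonneg {F : (Fin (n + 1) → Bool) → ℝ} (hF : ∀ x, 0 ≤ F x) (x : Fin (n + 1) → Bool)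
    (G : Fin (m + 1) → Perm (ZMod 3)) : 0 ≤ avgB a L m κ₀ F x G := by
  unfold avgB
  exact div_nonneg (Finset.sum_nonneg fun B _ => hF _) (Finset.prod_nonneg fun j _ => by positivity)


/-- Splitting a dependent function into two coordinate families. -/
def piProdSplit {ι : Type*} (α β : ι → Type*) : ((i : ι) → α i × β i) ≃ ((i : ι) → α i) × ((i : ι) → β i) where
  toFun f := (fun i => (f i).1, fun i => (f i).2)
  invFun p := fun i => (p.1 i, p.2 i)
  left_inv _ := rfl
  right_inv _ := rfl


/-- The interior boundary gauge recovering `G'` from `G`: `h_i = (G_0⋯G_i)⁻¹ (G'_0⋯G'_i)` (boundary `i+1`). -/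
def kil (G G' : Fin (m + 1) → Perm (ZMod 3)) (i : Fin m) : Perm (ZMod 3) :=
  (Fin.partialProd G ⟨i.val + 1, by omega⟩)⁻¹ * Fin.partialProd G' ⟨i.val + 1, by omega⟩


variable (a L m κ₀)

/-- Canonical outside contents: patterns vanishing on the window. -/
def Yset : Finset (Fin (n + 1) → Bool) := univ.filter fun y => out a L m y = y

/-- The number of zeros OUTSIDE the window. -/
def zerosOut (y : Fin (n + 1) → Bool) : ℕ :=
  (univ.filter fun j : Fin (n + 1) => ¬ (a ≤ j.val ∧ j.val < a + (m + 1) * L) ∧ y j = false).card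

/-- Admissibility of a window sign `σ` for the odd class, given the outside content. -/
abbrev AdmS (y : Fin (n + 1) → Bool) (σ : ZMod 3) : Prop := (zerosOut a L m y + (if σ = 1 then 0 else 1)) % 2 = 1

/-- The admissible sign bit: `true` (sign `+1`) iff the number of outside zeros is odd. -/
def εb (y : Fin (n + 1) → Bool) : Bool := decide (zerosOut a L m y % 2 = 1)

/-- The sign of a permutation of `𝔽₃` (as `±1 ∈ 𝔽₃`). -/
def sgnP (P : Perm (ZMod 3)) : ZMod 3 := P 1 - P 0

/-- The affine permutation with sign bit `b` and translation `t`: `z ↦ ỹ(b) z + t`. -/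
def affP (b : Bool) (t : ZMod 3) : Perm (ZMod 3) where
  toFun z := yt b * z + t
  invFun z := yt b * (z - t)
  left_inv z := by
    show yt b * (yt b * z + t - t) = z
    have h := yt_mul_self b
    linear_combination z * h
  right_inv z := by
    show yt b * (yt b * (z - t)) + t = z
    have h := yt_mul_self b
    linear_combination (z - t) * h

variable {a L m κ₀}

/-- Membership in `Yset`. -/
theorem mem_Yset {y : Fin (n + 1) → Bool} : y ∈ Yset a L m ↔ out a L m y = y := by simp [Yset]

/-- `out x ∈ Yset`. -/
theorem out_mem_Yset (x : Fin (n + 1) → Bool) : out a L m x ∈ Yset a L m := mem_Yset.2 (out_out x)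


variable (a L m κ₀)

/-- The sign of an affine permutation. -/
theorem sgnP_of_isAff {P : Perm (ZMod 3)} {e t : ZMod 3} (h : IsAff P e t) : sgnP P = e := by
  unfold sgnP; rw [h 1, h 0]; ring

/-- `affP b t` is affine with data `(ỹ(b), t)`. -/
theorem isAff_affP (b : Bool) (t : ZMod 3) : IsAff (affP b t) (yt b) t := fun _ => rfl

/-- The sign of `affP b t` is `ỹ(b)`. -/
theorem sgnP_affP (b : Bool) (t : ZMod 3) : sgnP (affP b t) = yt b := sgnP_of_isAff (isAff_affP b t)


/-- The blocks of `c ∈ {0,1}^{Kℓ}` as gadget inputs (junk `false` beyond `K`). -/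
def cbOf (c : Fin (K * ℓ) → Bool) (j : ℕ) (i : Fin ℓ) : Bool :=
  if h : j < K then c (BlockParity.idx ⟨j, h⟩ i) else false

/-- The structured window content. -/
def swin (fb : Fin Lf → Bool) (c : Fin (K * ℓ) → Bool) : Fin ((m + 1) * L) → Bool :=
  fun t => sword ℓ K (cbOf K ℓ c) fb t.val

/-- The structured pattern: outside content `y`, structured window. -/
def Sx (fb : Fin Lf → Bool) (y : Fin (n + 1) → Bool) (c : Fin (K * ℓ) → Bool) : Fin (n + 1) → Bool :=
  glue a L m y (swin L m K ℓ fb c)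

variable {a L m κ₀ K ℓ}


/-- The constant part of the structured stake (depends on the outside content only). -/
def t0Of (a L m : ℕ) (k n : ℕ) (b : Bool) (τ : ZMod 3) (y : Fin (n + 1) → Bool) : ZMod 3 :=
  trW (kappa k) (xN y) 0 a + sgnW (xN y) 0 a *
    (τ + yt b * trW (kappa k) (xN y) (a + (m + 1) * L) (n - (a + (m + 1) * L)))

/-- The coefficient of the structured stake: `sgnW_prefix · κ₀`. -/
def etaOf (a : ℕ) (κ₀ : ZMod 3) {n : ℕ} (y : Fin (n + 1) → Bool) : ZMod 3 := sgnW (xN y) 0 a * κ₀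


/-- A filler block realising `affP b τ` (fibres are non-empty for `Lf ≥ 3`). -/
def fbOf (hκ : κ₀ ≠ 0) (hLf : 3 ≤ Lf) (b : Bool) (τ : ZMod 3) : Fin Lf → Bool :=
  (fib_nonempty hκ hLf (affP b τ)).choose

/-- The chosen filler lies in the fibre. -/
theorem fbOf_mem (hκ : κ₀ ≠ 0) (hLf : 3 ≤ Lf) (b : Bool) (τ : ZMod 3) : fbOf hκ hLf b τ ∈ fib κ₀ Lf (affP b τ) :=
  (fib_nonempty hκ hLf (affP b τ)).choose_spec


end Vocab

end DWalk

end Summit.QuantumAdvantage.AdviceFreeQNC0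

end
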